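import Mathlib
import Literature.MathematicalPhysics.QuantumFieldTheory.Balaban1983to89.B2

/-!
# `Balaban1983to89.B2Sect2Statements` — T. Bałaban, *(Higgs)₂,₃ quantum fields in a finite volume. II. An upper
# bound*, Commun. Math. Phys. **86** (1982) 555–594 [Balaban1982Higgs2]: the Theorem (1.3) p. 556 and the numbered
# statements of Sect. 2 "The Upper Bound" — Propositions 2.1, 2.2, Lemmas 2.3, 2.5, Proposition 2.6, Lemma 2.7 — and
# the final-step claims (2.116)–(2.117) p. 582, typed as `def … : Prop` (proofs deferred)

statement-level skeleton of published theorems with citation tags; proofs where landed; nothing here is a claim about the Yang–Mills mass gap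

v1.3 (APPEND-ONLY REPAIR of the |T_ε| reading, 2026-08-21, lead ruling G.5-2 on the r01 F-remark of 2026-08-20T23:17Z):
the print's |T_ε| in (1.3) is the VOLUME of part I (1.21) p. 607, *"|Λ| = Σ_{x∈Λ} η^d = η^d (a number of points in Λ)"*,
i.e. |T_ε| = ε^d·#T_ε (constant in ε at fixed physical torus), not the site count; v1's `MainThm`/`UpperBound` read
`PartitionData.volT : ℕ` (#T_ε) in the exponent and are therefore WEAKER than the print as ε → 0.  The new §«v1.3»
at the end adds the printed reading over the SAME carrier plus the family of spacings `eps : I → ℝ`: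
`PartitionData.volEps` (= ε^d·#T_ε), `MainThmPrinted`, `UpperBoundPrinted`, `LowerBoundPrinted`,
`mainThmPrinted_of_bounds`, and the dictionary lemmas `volEps_one`, `mainThmPrinted_iff_mainThm_of_eps_one` (at ε = 1
the two readings coincide).  Decl of record for SKELETON row B2.Thm@556 becomes `MainThmPrinted`; every v1.2
declaration is byte-identical.

v1.2 (DOCSTRING ERRATUM, 2026-08-20, lit-balaban ref-1 note on render p017 + fold-owner re-read): Proposition 2.2's
additional factor is PRINTED `exp(−δ₀(dist(b, Ω^c) + dist(y, Ω^c)))` (p. 571 l. 3) — Ω^c, consistently with part I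
Prop. 2.1 (*"If Ω ⊂ Ω₀, then for δG_k(Ω, Ω₀, A) … the additional factor exp(−δ₀dist(supp f, Ω^c) − δ₀dist({x, x′}, Ω^c))"*,
p. 611); v1 of this file quoted and named it as `Ω₀^c` (fields `P22Setting.distΩ₀cB/distΩ₀cP`) — a transcription slip
of this unit, corrected below in the docstrings only (the carrier is abstract: the two fields are to be instantiated
with the distances to Ω^c; no declaration is changed or renamed).  The declaration of record for SKELETON row
B2.Prop2.2 is `B2StepK.Prop22Printed` (unit r14), which types the clause as printed; `Prop22Printed` below stays as the
alternative carrier shape.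

PDF held: `paper:balaban1982-cmp86-higgs23-ii` (journal page = PDF page + 554).  Renders read AS IMAGES by this unit:
`run/shared/lean/pub/pub-balaban/b2b-balaban-ref1/pages/1982-cmp86-higgs23-II/1982-cmp86-higgs23-II-p002, p012, p016,
p017, p020, p026, p027, p028-x2.png` (journal pp. 556, 566, 570, 571, 574, 580, 581, 582); OCR text for pp. 557–560.

CITATION HEADER.  Cell `lit-balaban` (mega-formalization, Phase 1), unit `lit-balaban-r02` (fold owner of B2 per
`HOME/SKELETON.md` §1), SKELETON rows B2.Thm@556, B2.Prop2.1, B2.Prop2.2, B2.Lem2.3, B2.Lem2.5, B2.Prop2.6, B2.Lem2.7,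
B2.Eq2.116, B2.Eq2.117 of `run/shared/lean/pub/lit-balaban/lit-balaban-r02/ROWS-B2.md`.  WHAT IS REPRODUCED: each
statement VERBATIM in the docstring, typed over a per-statement abstract CARRIER whose real-valued fields NAME the
printed quantities (suprema of the displayed deviations, kernels, volumes) and whose `Prop` fields name the printed
standing hypotheses (the restrictions (2.55) p. 570, the scalar/vector restrictions (2.16)–(2.17) p. 560 at scale
L^kε, "Ω and A satisfy the assumptions of Proposition I.2.1") — the house style of the sibling module `…B2`
(`L24Setting`/`Lemma24Printed` for Lemma 2.4, `P31Setting`/`Prop31Printed`, `Run`/`Claim342Printed`), which this file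
imports for `B2.Params` (d, L, b₀, p, R, r, a, γ₀, κ₀) and re-declares nothing of.  Every printed O(·) is read, as in
`B2.Lemma24Printed`, with ONE constant uniform over the family of instances (all steps k, all lattice spacings ε, all
fields obeying the stated restrictions) — the family index `I` of each `…Printed` def; the ∃ over constants sits
exactly where the print puts it (ref-1 F3).  Carrier clauses (ref-1 F6): the sets Λ_i^{(j)}, the blocks B^k(·), the
propagators G_k(Ω, A), C^{(k)}_{Λ}, the minimisers A^{(k)}, φ^{(k)} (2.56), the functional 𝒫^{(k),L^kε} of (2.43) and
the densities ρ^{(k),L^kε} are NOT constructed here (they are the D-rows B2.Eq2.44–B2.Eq2.52 of ROWS-B2.md, absent):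
the carriers expose only the scalar quantities the statements bound.  NOT HERE: Lemma 2.4 ((2.65)–(2.66), typed in
`…B2` as `Lemma24Printed`), Sect. 3 (Prop. 3.1, (3.29), (3.42): `…B2`, `…B2Sect3C`), the inductive estimate (2.43)
itself (a structure statement over the density tower; row B2.Eq2.43, absent), and every proof.  Value = typed
skeleton rows, NOT summit progress; nothing of the paper is asserted (each `def … : Prop` is consumed downstream
only as a hypothesis until a Phase-2 `theorem …_holds`).
-/

namespace Literature.MathematicalPhysics.QuantumFieldTheory.Balaban1983to89.B2Sect2Statements

/-! ## Theorem p. 556 (1.3) — the main result of parts I–II (lower bound proved in [1] = B1, upper bound here) -/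

/-- Carrier for ONE instance (ε, T_ε) of the Theorem: `volT` = |T_ε| (number of sites of the torus
T_ε ⊂ εℤ^d), `Z` = the partition function Z^ε = ∫dA∫dφ exp(−S^ε(A, φ)) of (1.2) for the action (1.1) p. 555 (with
the counterterms δm², E = E₀ + E₁ of part I "defined with the help of perturbation expansions").  Carrier clause
(F6): the action, the measures and the counterterms live inside `Z`; only the two printed numbers are exposed.
[cite: Balaban1982Higgs2, (1.1)–(1.2) p.555] -/
structure PartitionData where
  /-- |T_ε|. -/
  volT : ℕ
  /-- Z^ε of (1.2). -/
  Z : ℝ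

/-- **Theorem** p. 556 [PDF 2], verbatim: *"For the dimensions d = 2, 3 there exist the constants E₋, E₊ independent
of ε, T_ε and such that exp(−E₋|T_ε|) ≤ Z^ε ≤ exp(E₊|T_ε|). (1.3)"*  (p. 556: *"In the first part [1], we have
proved the first inequality above, the lower bound. Now we will prove the upper bound."*)  Typed reading: the family
index `I` ranges over (ε, T_ε) for the FIXED model parameters `P` (d = 2 or 3 is `P.Printed`'s clause); E₋, E₊ are
chosen before the instance. [cite: Balaban1982Higgs2, Theorem (1.3) p.556] -/
def MainThm (P : B2.Params) {I : Type} (fam : I → PartitionData) : Prop :=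
  P.Printed →
    ∃ Eminus Eplus : ℝ, ∀ i : I,
      Real.exp (-(Eminus * ((fam i).volT : ℝ))) ≤ (fam i).Z ∧ (fam i).Z ≤ Real.exp (Eplus * ((fam i).volT : ℝ))

/-- The upper-bound half of (1.3), the part proved in THIS paper (Sects. 2–3): ∃ E₊ ∀ (ε, T_ε), Z^ε ≤ exp(E₊|T_ε|).
[cite: Balaban1982Higgs2, Theorem (1.3) p.556] -/
def UpperBound (P : B2.Params) {I : Type} (fam : I → PartitionData) : Prop :=
  P.Printed → ∃ Eplus : ℝ, ∀ i : I, (fam i).Z ≤ Real.exp (Eplus * ((fam i).volT : ℝ))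

/-- bookkeeping: the Theorem is the conjunction of the lower bound (part I) and `UpperBound` (this paper), with the
constants chosen uniformly. [cite: Balaban1982Higgs2, Theorem (1.3) p.556] -/
theorem mainThm_of_bounds (P : B2.Params) {I : Type} (fam : I → PartitionData)
    (hlow : P.Printed → ∃ Eminus : ℝ, ∀ i : I, Real.exp (-(Eminus * ((fam i).volT : ℝ))) ≤ (fam i).Z)
    (hup : UpperBound P fam) : MainThm P fam := by
  intro hP
  obtain ⟨Em, hm⟩ := hlow hP
  obtain ⟨Ep, hp⟩ := hup hP
  exact ⟨Em, Ep, fun i => ⟨hm i, hp i⟩⟩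

/-! ## Sect. 2.C p. 570 — the restrictions (2.55) and Proposition 2.1 (2.57) -/

/-- Carrier for ONE instance (a step k of a run at lattice spacing ε, an admissible sequence Λ₀^{(0)}, …, Λ₀^{(k)},
fields B, ψ, A, φ) of Proposition 2.1: `scale` = L^kε; `restr255` ↤ "the conditions (2.55)" p. 570, i.e.
|(∂A)(b)| ≤ c₁p(L^{k−1}ε), |A(x)| ≤ (c₁/(μ₀L^{k−1}ε))p(L^{k−1}ε), |(D_{Ā^{(k)}}φ)(b)| ≤ c₁p(L^{k−1}ε),
|φ(x)| ≤ (c₁/λ(L^{k−1}ε)^{1/4})p(L^{k−1}ε) for x ∈ Λ_{−1}^{(k−1)′}, b ⊂ Λ_{−1}^{(k−1)′}, Ā^{(k)}_b =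
L^{−k}Σ_{⟨x,x′⟩⊂b}A^{(k)}_{⟨x,x′⟩}; `pFull` = 𝒫^{(k)}(Λ₇^{(k−1)′}, θ_kA^{(k)}, φ) (the functional of (2.43));
`quartic` = λ(L^kε)Σ_{x∈B^k(Λ₇^{(k−1)′}∩Λ₇^{(k)c})} η^d|φ^{(k)}(x)|⁴ with φ^{(k)} of (2.56), η = L^{−k}; `pIn` =
𝒫^{(k)}(Λ₇^{(k)}, θ_kA^{(k)}, φ); `vol` = |Λ₇^{(k−1)′} ∩ Λ₇^{(k)c}| (number of points).
[cite: Balaban1982Higgs2, (2.55)–(2.57) p.570] -/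
structure P21Setting where
  /-- L^kε. -/
  scale : ℝ
  /-- the conditions (2.55) hold. -/
  restr255 : Prop
  /-- 𝒫^{(k)}(Λ₇^{(k−1)′}, θ_kA^{(k)}, φ). -/
  pFull : ℝ
  /-- λ(L^kε) Σ_{x ∈ B^k(Λ₇^{(k−1)′} ∩ Λ₇^{(k)c})} η^d |φ^{(k)}(x)|⁴. -/
  quartic : ℝ
  /-- 𝒫^{(k)}(Λ₇^{(k)}, θ_kA^{(k)}, φ). -/
  pIn : ℝ
  /-- |Λ₇^{(k−1)′} ∩ Λ₇^{(k)c}|. -/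
  vol : ℕ

/-- **Proposition 2.1** p. 570 [PDF 16], verbatim: *"Under the conditions (2.55), we have
𝒫^{(k)}(Λ₇^{(k−1)′}, θ_kA^{(k)}, φ) = −λ(L^kε) Σ_{x∈B^k(Λ₇^{(k−1)′}∩Λ₇^{(k)c})} η^d|φ^{(k)}(x)|⁴ +
𝒫^{(k)}(Λ₇^{(k)}, θ_kA^{(k)}, φ) + O((L^kε)^{κ₀})|Λ₇^{(k−1)′} ∩ Λ₇^{(k)c}|. (2.57)"* (p. 570: *"Similar conclusions
hold for other expressions which will be included in the action in the later stages of the procedure. This theorem is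
a corollary of the analysis of the perturbation expansions."*)  Typed reading: ONE constant C, uniform over the family
(all k, ε, admissible sets, fields), bounds |𝒫(Λ₇^{(k−1)′}) + quartic − 𝒫(Λ₇^{(k)})| by C(L^kε)^{κ₀}·vol; κ₀ = `P.κ₀`
((2.11) p. 559: κ₀ = 1 for d = 3, 2 − α for d = 2). [cite: Balaban1982Higgs2, Prop. 2.1 (2.57) p.570] -/
def Prop21Printed (P : B2.Params) {I : Type} (fam : I → P21Setting) : Prop :=
  ∃ C : ℝ, ∀ i : I, (fam i).restr255 →
    |(fam i).pFull - (-(fam i).quartic + (fam i).pIn)| ≤ C * (fam i).scale ^ P.κ₀ * ((fam i).vol : ℝ)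

/-! ## Proposition 2.2 (2.58) pp. 570–571 — decay of D^η_A G_k(Ω, A)Q_k*(A) -/

/-- Carrier for ONE instance (k, Ω, Ω₀, A, lattice spacing) of Proposition 2.2: `hypI21` ↤ "Ω and A satisfy the
assumptions of Proposition I.2.1" (B1 = [1] Prop. 2.1 p. 610; tree `B1.Prop21Printed`); `e` = e(L^kε) (the
small parameter of Prop. I.2.1); `Bond` = bonds b ⊂ Ω, `Pt` = points y ∈ Ω^{(k)} (the carrier restricts to these —
F6); `dist b y`; `distΩc b` = dist(b, Ω^c); `distΩ₀cB b` = dist(b, Ω^c) and `distΩ₀cP y` = dist(y, Ω^c) of the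
printed additional factor [v1.2 ERRATUM: the print has Ω^c, NOT Ω₀^c — the subscript ₀ in these two field names is a
v1 transcription slip; instantiate both with the distance to Ω^c, so that `distΩ₀cB = distΩc`]; the four
kernels `kDGQ` = (D^η_AG_k(Ω,A)Q_k*(A))(b,y), `kGQ` = (G_k(Ω,A)Q_k*(A))(b,y) [read at the bond's base point],
`kDdGQ` = (D^η_AδG_k(Ω,Ω₀,A)Q_k*(A))(b,y), `kdGQ` = (δG_k(Ω,Ω₀,A)Q_k*(A))(b,y), as absolute values.
[cite: Balaban1982Higgs2, Prop. 2.2 (2.58) pp.570–571] -/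
structure P22Setting where
  hypI21 : Prop
  e : ℝ
  Bond : Type
  Pt : Type
  dist : Bond → Pt → ℝ
  distΩc : Bond → ℝ
  distΩ₀cB : Bond → ℝ
  distΩ₀cP : Pt → ℝ
  kDGQ : Bond → Pt → ℝ
  kGQ : Bond → Pt → ℝ
  kDdGQ : Bond → Pt → ℝ
  kdGQ : Bond → Pt → ℝ

/-- **Proposition 2.2** pp. 570–571 [PDF 16–17], verbatim: *"Let Ω and A satisfy the assumptions of Proposition I.2.1,
then for e(L^kε) sufficiently small there exist positive constants δ₀, c₀, R₀ independent of A, k, Ω and depending on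
d, a, M, such that |(D^η_AG_k(Ω, A)Q_k*(A))(b, y)| ≤ c₀exp(−δ₀dist(b, y)), (2.58) for b ⊂ Ω, dist(b, Ω^c) ≥ R₀,
y ∈ Ω^{(k)}. The identical inequality holds for G_k(Ω, A)Q_k*(A), and for D^η_AδG_k(Ω, Ω₀, A)Q_k*(A),
δG_k(Ω, Ω₀, A)Q_k*(A) with the additional factor exp(−δ₀(dist(b, Ω^c) + dist(y, Ω^c)))."*  (p. 571: *"This
proposition is a simple corollary of Proposition I.2.1."*)  [v1.2 ERRATUM: v1 misquoted the additional factor with Ω₀^c;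
the print (render p017 l. 3) and part I Prop. 2.1 p. 611 have Ω^c; the fields `distΩ₀cB/distΩ₀cP` denote these
distances to Ω^c.]  Typed reading (F3): "for e(L^kε) sufficiently small there
exist δ₀, c₀, R₀ independent of A, k, Ω" ⇒ ∃ e₀ > 0 and δ₀, c₀, R₀ > 0 BEFORE the instance; the instance enters under
`hypI21` and `e ≤ e₀`. [cite: Balaban1982Higgs2, Prop. 2.2 (2.58) pp.570–571] -/
def Prop22Printed {I : Type} (fam : I → P22Setting) : Prop :=
  ∃ e₀ δ₀ c₀ R₀ : ℝ, 0 < e₀ ∧ 0 < δ₀ ∧ 0 < c₀ ∧ 0 < R₀ ∧ ∀ i : I, (fam i).hypI21 → (fam i).e ≤ e₀ →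
    ∀ (b : (fam i).Bond) (y : (fam i).Pt), R₀ ≤ (fam i).distΩc b →
      |(fam i).kDGQ b y| ≤ c₀ * Real.exp (-(δ₀ * (fam i).dist b y)) ∧
      |(fam i).kGQ b y| ≤ c₀ * Real.exp (-(δ₀ * (fam i).dist b y)) ∧
      |(fam i).kDdGQ b y| ≤ c₀ * Real.exp (-(δ₀ * (fam i).dist b y)) *
          Real.exp (-(δ₀ * ((fam i).distΩ₀cB b + (fam i).distΩ₀cP y))) ∧
      |(fam i).kdGQ b y| ≤ c₀ * Real.exp (-(δ₀ * (fam i).dist b y)) *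
          Real.exp (-(δ₀ * ((fam i).distΩ₀cB b + (fam i).distΩ₀cP y)))

/-! ## Lemma 2.3 (2.59)–(2.60) p. 571 — the block field A^{(k)} under (2.55) -/

/-- Carrier for ONE instance of Lemma 2.3 (step k, field A obeying (2.55), A^{(k)} = a_kG_kQ_k*… of (2.44)/(2.61)):
`p` = p(L^kε); `restr255`; `dev259a` = sup over y ∈ Λ₂^{(k−1)′}, x ∈ B^k(y) of |A^{(k)}(x) − A(y)|; `dev259b` = the same
sup of |A^{(k)}(x) − (Q_k*A)(x)|; `dev260` = sup over x ∈ B^k(Λ₂^{(k−1)′}), μ of |(∂^η_μA^{(k)})(x)|.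
[cite: Balaban1982Higgs2, Lemma 2.3 (2.59)–(2.60) p.571] -/
structure L23Setting where
  p : ℝ
  restr255 : Prop
  dev259a : ℝ
  dev259b : ℝ
  dev260 : ℝ

/-- **Lemma 2.3** p. 571 [PDF 17], verbatim: *"Under the restrictions (2.55), we have A^{(k)}(x) = A(y) + O(p(L^kε)) =
(Q_k*A)(x) + O(p(L^kε)), x ∈ B^k(y), y ∈ Λ₂^{(k−1)′}, (2.59)  (∂^η_μA^{(k)})(x) = O(p(L^kε)), x ∈ B^k(Λ₂^{(k−1)′}).
(2.60)"*  (p. 571: *"The inequality (2.60) implies that the configuration A^{(k)} considered on the set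
B^k(Λ₂^{(k−1)′}) satisfies the assumption of Proposition I.2.1. on a vector field configuration."*)  O(·) uniform over
the family. [cite: Balaban1982Higgs2, Lemma 2.3 (2.59)–(2.60) p.571] -/
def Lemma23Printed {I : Type} (fam : I → L23Setting) : Prop :=
  ∃ C : ℝ, ∀ i : I, (fam i).restr255 →
    (fam i).dev259a ≤ C * (fam i).p ∧ (fam i).dev259b ≤ C * (fam i).p ∧ (fam i).dev260 ≤ C * (fam i).p

/-! ## Lemma 2.5 (2.81) p. 574 and Lemma 2.7 (2.113) p. 581 — the translations (2.80), (2.110) are small shifts -/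

/-- Carrier for ONE instance of Lemma 2.5 (step k, vector field B on the unit lattice T^{(k)′} with the restrictions
(2.17) at scale L^kε — p. 574: *"The restrictions on the fields A, φ introduced by the characteristic functions
χ_{Λ₋₁^{(k)}} imply the corresponding restrictions (2.16), (2.17), with ε replaced by L^kε, on the fields B, ψ."* —
`restrB`); `p` = p(L^kε); `dev281a` = sup over y ∈ Λ₁^{(k)′}, x ∈ B(y) of |aL⁻²(C^{(k)}_{Λ₀^{(k)}}Q*B)(x) − B(y)|;
`dev281b` = the same sup of |aL⁻²(C^{(k)}_{Λ₀^{(k)}}Q*B)(x) − (Q*B)(x)| (C^{(k)}_{Λ₀^{(k)}} = the covariance with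
Dirichlet conditions outside Λ₀^{(k)}, Chap. I.2 / Prop. I.2.3). [cite: Balaban1982Higgs2, Lemma 2.5 (2.81) p.574] -/
structure L25Setting where
  p : ℝ
  restrB : Prop
  dev281a : ℝ
  dev281b : ℝ

/-- **Lemma 2.5** p. 574 [PDF 20], verbatim: *"aL⁻²(C^{(k)}_{Λ₀^{(k)}}Q*B)(x) = B(y) + O(p(L^kε)) = (Q*B)(x) +
O(p(L^kε)), x ∈ B(y), y ∈ Λ₁^{(k)′}. (2.81)"* (proof p. 574: *"where Proposition I.2.3 and the restrictions on the
field B were used"* — hence the hypothesis `restrB`).  O(·) uniform over the family. [cite: Balaban1982Higgs2, Lemma 2.5 (2.81) p.574] -/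
def Lemma25Printed {I : Type} (fam : I → L25Setting) : Prop :=
  ∃ C : ℝ, ∀ i : I, (fam i).restrB → (fam i).dev281a ≤ C * (fam i).p ∧ (fam i).dev281b ≤ C * (fam i).p

/-- Carrier for ONE instance of Lemma 2.7 (step k, scalar field ψ on T^{(k)′} with the restrictions (2.16) at scale
L^kε — `restrψ`, p. 581: *"Lemma 2.7 and the restrictions on the fields ψ, φ imply (2.114)"*); `p` = p(L^kε);
`dev2113` = sup over x ∈ Λ₅^{(k)} of |aL⁻²(C^{(k)}_{Λ₄^{(k)}}(B^k(Λ₂^{(k)}), B^{(k+1),η})Q*(B^{(k+1),η})ψ)(x) −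
(Q*(B^{(k+1),η})ψ)(x)|. [cite: Balaban1982Higgs2, Lemma 2.7 (2.113) p.581] -/
structure L27Setting where
  p : ℝ
  restrψ : Prop
  dev2113 : ℝ

/-- **Lemma 2.7** p. 581 [PDF 27], verbatim: *"The following estimate holds aL⁻²(C^{(k)}_{Λ₄^{(k)}}(B^k(Λ₂^{(k)}),
B^{(k+1),η})Q*(B^{(k+1),η})ψ)(x) = (Q*(B^{(k+1),η})ψ)(x) + O(p(L^kε)), x ∈ Λ₅^{(k)}. (2.113)"* (p. 581: *"A proof
of this lemma is based on the ideas which were described before in the proofs of Lemmas 2.4 and 2.5, so we omit it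
here."* — no proof in print).  O(·) uniform over the family. [cite: Balaban1982Higgs2, Lemma 2.7 (2.113) p.581] -/
def Lemma27Printed {I : Type} (fam : I → L27Setting) : Prop :=
  ∃ C : ℝ, ∀ i : I, (fam i).restrψ → (fam i).dev2113 ≤ C * (fam i).p

/-- the printed consequence (2.114) p. 581: *"|φ′(x)| ≤ O(1)p(L^kε), x ∈ Λ₅^{(k)}"*, as a statement about a family of
instances exposing `p` = p(L^kε) and `supφ'` = sup_{x∈Λ₅^{(k)}}|φ′(x)|, under the restrictions on ψ, φ (`restr`).
[cite: Balaban1982Higgs2, (2.114) p.581] -/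
def Ineq2114 {I : Type} (p supφ' : I → ℝ) (restr : I → Prop) : Prop :=
  ∃ C : ℝ, ∀ i : I, restr i → supφ' i ≤ C * p i

/-! ## Proposition 2.6 p. 580 — change of the propagator in the interaction terms -/

/-- Carrier for ONE instance of Proposition 2.6 (step k; the interaction terms localized in B^k(Λ₇^{(k)}) as produced
by the procedure of Sect. 2.C): `scale` = L^kε; `diffTerms` = the sum of all the terms containing at least one
difference G_k(B^{k−1}(Λ₂^{(k−1)}), B̃) − G_k(B^k(Λ₂^{(k)}), B^{(k+1),η}) after the replacement; `vol7` = |Λ₇^{(k)}|;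
`ctx` ↤ the standing context of Sect. 2.C at step k (restrictions (2.55), admissible sets) — F6.
[cite: Balaban1982Higgs2, Prop. 2.6 p.580] -/
structure P26Setting where
  scale : ℝ
  ctx : Prop
  diffTerms : ℝ
  vol7 : ℕ

/-- **Proposition 2.6** p. 580 [PDF 26], verbatim: *"If in the interaction terms localized in B^k(Λ₇^{(k)}) we replace
the propagator G_k(B^{k−1}(Λ₂^{(k−1)}), B̃) by G_k(B^k(Λ₂^{(k)}), B^{(k+1),η}), then all the terms containing at least
one difference of these propagators can be estimated by O((L^kε)^κ)|Λ₇^{(k)}|."*  Typed reading: `κ` is the exponent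
κ > d of p. 568 (*"we estimate unnecessary terms by O((L^{k−1}ε)^κ)|Λ₇^{(k−1)}| with κ > d"*), a parameter of the
statement; ONE constant uniform over the family. [cite: Balaban1982Higgs2, Prop. 2.6 p.580] -/
def Prop26Printed (κ : ℝ) {I : Type} (fam : I → P26Setting) : Prop :=
  ∃ C : ℝ, ∀ i : I, (fam i).ctx → |(fam i).diffTerms| ≤ C * (fam i).scale ^ κ * ((fam i).vol7 : ℝ)

/-! ## Sect. 2.D p. 582 — the final step: (2.116) and the reduction of the upper bound to (2.117) -/

/-- **(2.116)** p. 582 [PDF 28], verbatim: *"The procedure is continued until k = K, where K is such that L^Kε ≤ ε₀,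
L^{K+1}ε > ε₀. Then we estimate 𝒫^{(K),L^Kε}(Λ₇^{(K−1)}, B^{(K),ε}, ψ) ≤ O((L^Kε)^{κ₀})|Λ₇^{(K)}|. (2.116)"* — over a
family of final-step instances exposing `scaleK` = L^Kε, `pK` = the left side, `vol7K` = |Λ₇^{(K)}|, under the
standing context `ctx`. [cite: Balaban1982Higgs2, (2.116) p.582] -/
def Ineq2116 (P : B2.Params) {I : Type} (scaleK pK : I → ℝ) (vol7K : I → ℕ) (ctx : I → Prop) : Prop :=
  ∃ C : ℝ, ∀ i : I, ctx i → pK i ≤ C * scaleK i ^ P.κ₀ * (vol7K i : ℝ)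

/-- Carrier for ONE instance (ε, T_ε, with its stopping scale K) of the claim (2.117): `volT` = |T_ε|; for GIVEN
constants `C7` (the O(1)'s inside the exponent on the left, coming from (2.43)/(2.57)), `lhs C7` = ∫dB∫dψ
Σ_{Λ₀^{(0)},…,Λ₀^{(K−1)}} ρ^{(K),L^Kε}(Λ₀^{(0)}, …, Λ₀^{(K−1)}, B, θ_KB^{(K),ε}, ψ)exp(−E₀)·exp(C7·ε^{κ₀}|Λ₇^{(0)c}| +
Σ_{j=1}^{K−1} C7(L^jε)^{κ₀}|Λ₇^{(j−1)′}∩Λ₇^{(j)c}| + C7(L^{K−1}ε)^{κ₀}|Λ₇^{(K−1)}|).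
[cite: Balaban1982Higgs2, (2.117) p.582] -/
structure FinalRun where
  volT : ℕ
  lhs : ℝ → ℝ

/-- **(2.117)** p. 582 [PDF 28], verbatim: *"Now it is sufficient to prove the estimate ∫dB∫dψ Σ_{Λ₀^{(0)},…,Λ₀^{(K−1)}}
ρ^{(K),L^Kε}(Λ₀^{(0)}, …, Λ₀^{(K−1)}, B, θ_KB^{(K),ε}, ψ)exp(−E₀)·exp(O(1)ε^{κ₀}|Λ₇^{(0)c}| + Σ_{j=1}^{K−1}
O(1)(L^jε)^{κ₀}|Λ₇^{(j−1)′}∩Λ₇^{(j)c}| + O(1)(L^{K−1}ε)^{κ₀}|Λ₇^{(K−1)}|) ≤ exp(O(1)|T_ε|), (2.117) with the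
constant O(1) independent of ε"* … *"The inequality (2.117) will be proved in the next chapter."* (its combinatorial
core is (3.42), typed as `B2.Claim342Printed`).  Typed reading (F3): for every given left-side constant C7 there is a
right-side constant C, independent of the instance (ε, T_ε) — the stopping scale ε₀ is part of the procedure and sits
inside the carrier. [cite: Balaban1982Higgs2, (2.117) p.582] -/
def Claim2117Printed {I : Type} (fam : I → FinalRun) : Prop :=
  ∀ C7 : ℝ, ∃ C : ℝ, ∀ i : I, (fam i).lhs C7 ≤ Real.exp (C * ((fam i).volT : ℝ))

/-- the printed arithmetic of (2.118) p. 582: *"Σ_{j=0}^{K−1} O((L^jε)^κ)|T₁^{(j)}| = Σ_{j=0}^{K−1} O(1)(L^jε)^{κ₀}|T_ε|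
≤ O(1)|T_ε|"* — its model-independent core: with |T₁^{(j)}| = (L^jε)^{−d}|T_ε|·ε^d… the print uses κ − d ≥ κ₀ and the
geometric sum Σ_j (L^jε)^{κ₀} ≤ ε₀^{κ₀}/(1 − L^{−κ₀}); here the LAST step only, kernel-checked: a geometric series
with ratio L^{−κ₀} < 1 dominated termwise is bounded by its limit. [cite: Balaban1982Higgs2, (2.118) p.582] -/
theorem sum2118_geometric (K : ℕ) (q top : ℝ) (hq0 : 0 ≤ q) (hq1 : q < 1) (htop : 0 ≤ top) (x : ℕ → ℝ)
    (hx : ∀ j, j < K → x j ≤ top * q ^ j) :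
    (Finset.range K).sum x ≤ top / (1 - q) := by
  have h1 : (Finset.range K).sum x ≤ (Finset.range K).sum fun j => top * q ^ j :=
    Finset.sum_le_sum fun j hj => hx j (Finset.mem_range.mp hj)
  have h2 : ((Finset.range K).sum fun j => top * q ^ j) = top * (Finset.range K).sum fun j => q ^ j := by
    rw [Finset.mul_sum]
  have h3 : ((Finset.range K).sum fun j => q ^ j) ≤ 1 / (1 - q) := by
    have h := geom_sum_Ico_le_of_lt_one (m := 0) (n := K) hq0 hq1
    rw [pow_zero] at h
    rwa [Finset.range_eq_Ico]
  calc (Finset.range K).sum x ≤ top * (Finset.range K).sum fun j => q ^ j := by rw [← h2]; exact h1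
    _ ≤ top * (1 / (1 - q)) := mul_le_mul_of_nonneg_left h3 htop
    _ = top / (1 - q) := by rw [mul_one_div]


/-! ## Addendum (same unit, after p239259 landed): Sect. 2.A (2.2)–(2.3) PROVED; (2.16)–(2.17), (2.109), (2.43) typed -/

/-- (2.2)–(2.3) p. 557, core step: `exp(−κt²) ≤ exp(−c₀p²)` when `|t| > p ≥ 0`, `0 ≤ c₀ ≤ κ`. [cite: Balaban1982Higgs2, (2.2)–(2.3) p.557] -/
theorem exp_quadratic_le {κ c₀ t p : ℝ} (hc : c₀ ≤ κ) (hc0 : 0 ≤ c₀) (hp : 0 ≤ p) (ht : p < |t|) :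
    Real.exp (-(κ * t ^ 2)) ≤ Real.exp (-(c₀ * p ^ 2)) := by
  have h1 : p ^ 2 ≤ t ^ 2 := by
    rw [← sq_abs t]; exact pow_le_pow_left₀ hp ht.le 2
  have h2 : c₀ * p ^ 2 ≤ κ * t ^ 2 :=
    (mul_le_mul_of_nonneg_left h1 hc0).trans (mul_le_mul_of_nonneg_right hc (sq_nonneg t))
  exact Real.exp_le_exp.mpr (by linarith)

/-- **(2.2)–(2.3)** p. 557 [PDF 3], verbatim: *"If any of the following inequalities holds |B(y) − (QA)(y)| > p(ε),
|(∂A)(b)| > p(ε), |A(x)| > (1/(μ₀ε))p(ε), |ψ(y) − (Q(A)φ)(y)| > p(ε), (2.2) |(D_Aφ)(b)| > p(ε), |φ(x)| >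
(1/(λε^{4−d})^{1/4})p(ε); then the corresponding factor in (2.1) satisfies the inequality exp(−(…)) ≤ exp(−c₀p(ε)²),
(2.3) with some positive constant c₀, e.g. c₀ = ½min{a, 1}."*  PROVED for the six factors of (2.1)
(½aL^{d−2}|·|², ½|·|², ½μ₀²ε²|·|², ½aL^{d−2}|·|², ½|·|², λε^{4−d}|·|⁴), c₀ = ½min{a,1}, under `1 ≤ L^{d−2}` (L > 1,
d = 2, 3) and `1 ≤ p(ε)` (needed for the quartic factor only; its threshold `m = (λε^{4−d})^{−1/4}` enters through
`m⁴·(λε^{4−d}) = 1`, `quarticThreshold_pow`). [cite: Balaban1982Higgs2, (2.2)–(2.3) p.557] -/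
theorem smallFactor23 {a Lpow μ₀ε g m p t : ℝ} (ha : 0 < a) (hL : 1 ≤ Lpow) (hμ : 0 < μ₀ε) (hg : 0 < g)
    (hm : 0 < m) (hmg : m ^ 4 * g = 1) (hp : 1 ≤ p) :
    (p < |t| → Real.exp (-(1 / 2 * a * Lpow * t ^ 2)) ≤ Real.exp (-(1 / 2 * min a 1 * p ^ 2))) ∧
    (p < |t| → Real.exp (-(1 / 2 * t ^ 2)) ≤ Real.exp (-(1 / 2 * min a 1 * p ^ 2))) ∧
    (p / μ₀ε < |t| → Real.exp (-(1 / 2 * μ₀ε ^ 2 * t ^ 2)) ≤ Real.exp (-(1 / 2 * min a 1 * p ^ 2))) ∧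
    (m * p < |t| → Real.exp (-(g * t ^ 4)) ≤ Real.exp (-(1 / 2 * min a 1 * p ^ 2))) := by
  have hp0 : 0 ≤ p := by linarith
  have hc0 : 0 ≤ 1 / 2 * min a 1 := by positivity
  have hca : 1 / 2 * min a 1 ≤ 1 / 2 * a := by have := min_le_left a 1; linarith
  have hc1 : 1 / 2 * min a 1 ≤ 1 / 2 := by have := min_le_right a 1; linarith
  refine ⟨fun ht => ?_, fun ht => ?_, fun ht => ?_, fun ht => ?_⟩
  · have hκ : 1 / 2 * min a 1 ≤ 1 / 2 * a * Lpow := by nlinarith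
    simpa [mul_assoc] using exp_quadratic_le (t := t) hκ hc0 hp0 ht
  · simpa using exp_quadratic_le (κ := 1 / 2) (t := t) hc1 hc0 hp0 ht
  · have ht' : p < |μ₀ε * t| := by
      rw [abs_mul, abs_of_pos hμ]; rwa [div_lt_iff₀' hμ] at ht
    have h := exp_quadratic_le (κ := 1 / 2) (t := μ₀ε * t) hc1 hc0 hp0 ht'
    simpa [mul_pow, mul_assoc, mul_left_comm] using h
  · apply Real.exp_le_exp.mpr
    have h1 : m * p < |t| := ht
    have h2 : (m * p) ^ 4 ≤ t ^ 4 := by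
      have h0 : 0 ≤ m * p := by positivity
      have := pow_le_pow_left₀ h0 h1.le 4
      rwa [Even.pow_abs (by decide) t] at this
    have h3 : g * t ^ 4 ≥ p ^ 4 := by
      have : g * (m * p) ^ 4 = p ^ 4 := by
        rw [mul_pow, ← mul_assoc, mul_comm g, hmg, one_mul]
      nlinarith [mul_le_mul_of_nonneg_left h2 hg.le]
    have h4 : p ^ 2 ≤ p ^ 4 := by
      have hp2 : 1 ≤ p ^ 2 := by nlinarith
      calc p ^ 2 = p ^ 2 * 1 := by ring
        _ ≤ p ^ 2 * p ^ 2 := mul_le_mul_of_nonneg_left hp2 (sq_nonneg p)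
        _ = p ^ 4 := by ring
    have h5 : 1 / 2 * min a 1 * p ^ 2 ≤ p ^ 2 := by nlinarith [sq_nonneg p]
    linarith

/-- the printed quartic threshold: for g = λε^{4−d} > 0, m := g^{−1/4} satisfies m⁴·g = 1 and m > 0.
[cite: Balaban1982Higgs2, (2.2) p.557] -/
theorem quarticThreshold_pow {g : ℝ} (hg : 0 < g) :
    0 < g ^ (-(1 / 4 : ℝ)) ∧ (g ^ (-(1 / 4 : ℝ))) ^ 4 * g = 1 := by
  refine ⟨Real.rpow_pos_of_pos hg _, ?_⟩
  rw [← Real.rpow_natCast, ← Real.rpow_mul hg.le]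
  norm_num
  rw [Real.rpow_neg_one, inv_mul_cancel₀ hg.ne']

/-- Carrier for ONE instance (a step at scale s = L^kε — p. 560: *"The same estimates as (2.16), (2.17) will hold for
the fields in each step with ε replaced by the corresponding L^kε"*): `p` = p(s), `L`, `d`, `lam` = λ(s), `mu0s` = μ₀s;
`restrSmall` ↤ the negations of (2.2) on Λ′₋₁; the six suprema of (2.16)/(2.17) over their printed ranges (x ∈ B(y);
y ∈ Λ′₋₁; ⟨y,y′⟩ ∈ Λ′*₋₁). [cite: Balaban1982Higgs2, (2.16)–(2.17) p.560] -/
structure R216Setting where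
  p : ℝ
  L : ℝ
  d : ℕ
  lam : ℝ
  mu0s : ℝ
  restrSmall : Prop
  supψUφ : ℝ
  supψ : ℝ
  supUψψ : ℝ
  supBA : ℝ
  supB : ℝ
  supBB : ℝ

/-- **(2.16)–(2.17)** p. 560 [PDF 6], verbatim: *"|ψ(y) − U(A(Γ_{y,x}))φ(x)| ≤ 2Ldp(ε) for x ∈ B(y), |ψ(y)| ≤
(2/λ(ε)^{1/4})p(ε) for y ∈ Λ′₋₁, |U(A(⟨y, y′⟩))ψ(y′) − ψ(y)| ≤ 3Ldp(ε) for ⟨y, y′⟩ ∈ Λ′*₋₁ (2.16) … |B(y) − A(x)|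
≤ 2Ldp(ε) for x ∈ B(y), and |B(y)| ≤ (2/(μ₀ε))p(ε) for y ∈ Λ′₋₁, |B(y) − B(y′)| ≤ 3Ldp(ε) for ⟨y, y′⟩ ∈ Λ′*₋₁
(2.17)"* — consequences of the small-field restrictions (p. 559). [cite: Balaban1982Higgs2, (2.16)–(2.17) p.560] -/
def Restr216Printed (X : R216Setting) : Prop :=
  X.restrSmall →
    X.supψUφ ≤ 2 * X.L * X.d * X.p ∧ X.supψ ≤ 2 / X.lam ^ (1 / 4 : ℝ) * X.p ∧ X.supUψψ ≤ 3 * X.L * X.d * X.p ∧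
    X.supBA ≤ 2 * X.L * X.d * X.p ∧ X.supB ≤ 2 / X.mu0s * X.p ∧ X.supBB ≤ 3 * X.L * X.d * X.p

/-- **(2.109)** p. 580 [PDF 26], verbatim: *"the difference between the quadratic forms is a quadratic form
½⟨Λ₆^{(k−1)′}φ, H_kΛ₆^{(k−1)′}φ⟩ and for the matrix elements h_k(x, x′) of the operator H_k of this form, the following
inequality holds |h_k(x, x′)| ≤ O(1)exp(−δ₁r(L^kε))exp(−δ₀|x − x′|) ≤ O((L^kε)^κ)exp(−δ₀|x − x′|) (2.109) for
x, x′ ∈ Λ₆^{(k−1)′} and arbitrary κ."* — the FIRST inequality, over a family of steps exposing the kernel `h`, the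
distance and `r` = r(L^kε) (∃ O(1), δ₀, δ₁ before the instance). [cite: Balaban1982Higgs2, (2.109) p.580] -/
def Ineq2109 {I : Type} (X : I → Type) (h dist : ∀ i, X i → X i → ℝ) (r : I → ℝ) : Prop :=
  ∃ C δ₀ δ₁ : ℝ, 0 < δ₀ ∧ 0 < δ₁ ∧ ∀ i (x x' : X i),
    |h i x x'| ≤ C * Real.exp (-(δ₁ * r i)) * Real.exp (-(δ₀ * dist i x x'))

/-- Carrier for ONE k-step instance of the inductive estimate (2.43): `Z` = Z^ε; `Seq` = the finite set of admissible
sequences (Λ₀^{(0)}, …, Λ₀^{(k−1)}) (p. 566); `integrand C₇ s` = ∫dA∫dφ ρ^{(k),L^kε}(Λ₀^{(0)},…,Λ₀^{(k−1)}, A,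
θ_kA^{(k),ε}, φ)·exp(𝒫^{(k),L^kε}(Λ₇^{(k−1)′}, θ_kA^{(k),ε}, φ) − E₀ + Σ_{j<k} C₇(L^jε)^{κ₀}|Λ₇^{(j−1)′}∩Λ₇^{(j)c}|)
for the sequence s and a GIVEN constant C₇; `scale j` = L^jε; `volT1 j` = |T₁^{(j)}|.  Everything printed in
(2.44)–(2.52) lives inside `integrand` (F6). [cite: Balaban1982Higgs2, (2.43) p.566] -/
structure Run243 where
  Z : ℝ
  k : ℕ
  Seq : Type
  [fin : Fintype Seq]
  integrand : ℝ → Seq → ℝ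
  scale : ℕ → ℝ
  volT1 : ℕ → ℕ

/-- **(2.43)** p. 566 [PDF 12] (the estimate after k steps; p. 582: *"Gathering together all the estimates, we get
the inequality (2.43) but with k + 1 instead of k"*): `Z^ε ≤ Σ_{admissible sequences} [∫dA∫dφ ρ^{(k),L^kε} ⋯
exp(𝒫^{(k),L^kε} − E₀ + Σ_{j=0}^{k−1} O((L^jε)^{κ₀})|Λ₇^{(j−1)′}∩Λ₇^{(j)c}|)] · exp(Σ_{j=0}^{k−1} O((L^jε)^κ)|T₁^{(j)}|)`,
constants uniform over the family of runs (all ε) and steps. [cite: Balaban1982Higgs2, (2.43) p.566] -/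
def Ineq243Printed (κ : ℝ) {I : Type} (fam : I → Run243) : Prop :=
  ∃ C₇ C : ℝ, ∀ i : I,
    (fam i).Z ≤ (@Finset.univ _ (fam i).fin).sum ((fam i).integrand C₇) *
      Real.exp (∑ j ∈ Finset.range (fam i).k, C * (fam i).scale j ^ κ * ((fam i).volT1 j : ℝ))

/-! ## v1.3 — the Theorem (1.3) with the PRINTED volume |T_ε| = ε^d·#T_ε (part I (1.21)); append-only repair -/

/-- The printed volume of the torus of ONE instance: part I (1.21) p. 607, verbatim, *"For the subsets Λ of the lattice
ηZ^d a measure is defined by the formula |Λ| = Σ_{x∈Λ} η^d = η^d (a number of points in Λ). (1.21)"*, so for the torus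
T_ε ⊂ εZ^d of (1.3): `|T_ε| = ε^d · #T_ε` — the carrier's site count `volT` times `eps ^ d` (d and ε supplied by the
statement; `PartitionData` itself is unchanged). [cite: Balaban1982Higgs2, (1.3) p.556] -/
def PartitionData.volEps (d : ℕ) (eps : ℝ) (X : PartitionData) : ℝ := eps ^ d * (X.volT : ℝ)

/-- at ε = 1 the printed volume is the site count. [cite: Balaban1982Higgs2, (1.3) p.556] -/
theorem PartitionData.volEps_one (d : ℕ) (X : PartitionData) : X.volEps d 1 = (X.volT : ℝ) := by
  simp [PartitionData.volEps]

/-- the printed volume is non-negative for ε ≥ 0. [cite: Balaban1982Higgs2, (1.3) p.556] -/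
theorem PartitionData.volEps_nonneg (d : ℕ) {eps : ℝ} (heps : 0 ≤ eps) (X : PartitionData) : 0 ≤ X.volEps d eps :=
  mul_nonneg (pow_nonneg heps d) (Nat.cast_nonneg _)

/-- **Theorem** p. 556 [PDF 2] (1.3), verbatim: *"For the dimensions d = 2, 3 there exist the constants E₋, E₊
independent of ε, T_ε and such that exp(−E₋|T_ε|) ≤ Z^ε ≤ exp(E₊|T_ε|). (1.3)"* — the PRINTED reading (v1.3): the
family index `I` ranges over the instances (ε, T_ε) of the fixed model `P` (d = `P.d` ∈ {2, 3} is a clause of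
`P.Printed`), `eps i` is the lattice spacing ε of instance `i`, and |T_ε| = ε^d·#T_ε (`volEps`); E₋, E₊ are chosen
before the instance ("independent of ε, T_ε").  Supersedes v1's `MainThm` (site-count reading) as the declaration of
record of SKELETON row B2.Thm@556. [cite: Balaban1982Higgs2, Theorem (1.3) p.556] -/
def MainThmPrinted (P : B2.Params) {I : Type} (eps : I → ℝ) (fam : I → PartitionData) : Prop :=
  P.Printed →
    ∃ Eminus Eplus : ℝ, ∀ i : I,
      Real.exp (-(Eminus * (fam i).volEps P.d (eps i))) ≤ (fam i).Z ∧
        (fam i).Z ≤ Real.exp (Eplus * (fam i).volEps P.d (eps i))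

/-- The upper-bound half of (1.3) in the printed reading — the part proved in THIS paper: ∃ E₊ ∀ (ε, T_ε),
Z^ε ≤ exp(E₊ ε^d #T_ε). [cite: Balaban1982Higgs2, Theorem (1.3) p.556] -/
def UpperBoundPrinted (P : B2.Params) {I : Type} (eps : I → ℝ) (fam : I → PartitionData) : Prop :=
  P.Printed → ∃ Eplus : ℝ, ∀ i : I, (fam i).Z ≤ Real.exp (Eplus * (fam i).volEps P.d (eps i))

/-- The lower-bound half of (1.3) in the printed reading — part I's Theorem ([1] = B1 (1.14) p. 606), restated here in
the words of p. 556: *"In the first part [1], we have proved the first inequality above, the lower bound."*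
[cite: Balaban1982Higgs2, Theorem (1.3) p.556] -/
def LowerBoundPrinted (P : B2.Params) {I : Type} (eps : I → ℝ) (fam : I → PartitionData) : Prop :=
  P.Printed → ∃ Eminus : ℝ, ∀ i : I, Real.exp (-(Eminus * (fam i).volEps P.d (eps i))) ≤ (fam i).Z

/-- bookkeeping (printed reading): the Theorem is the conjunction of the lower bound (part I) and the upper bound (this
paper), constants chosen uniformly over the family. [cite: Balaban1982Higgs2, Theorem (1.3) p.556] -/
theorem mainThmPrinted_of_bounds (P : B2.Params) {I : Type} (eps : I → ℝ) (fam : I → PartitionData)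
    (hlow : LowerBoundPrinted P eps fam) (hup : UpperBoundPrinted P eps fam) : MainThmPrinted P eps fam := by
  intro hP
  obtain ⟨Em, hm⟩ := hlow hP
  obtain ⟨Ep, hp⟩ := hup hP
  exact ⟨Em, Ep, fun i => ⟨hm i, hp i⟩⟩

/-- … and conversely the Theorem gives both halves. [cite: Balaban1982Higgs2, Theorem (1.3) p.556] -/
theorem bounds_of_mainThmPrinted (P : B2.Params) {I : Type} (eps : I → ℝ) (fam : I → PartitionData)
    (h : MainThmPrinted P eps fam) : LowerBoundPrinted P eps fam ∧ UpperBoundPrinted P eps fam := by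
  refine ⟨fun hP => ?_, fun hP => ?_⟩
  · obtain ⟨Em, _, hh⟩ := h hP
    exact ⟨Em, fun i => (hh i).1⟩
  · obtain ⟨_, Ep, hh⟩ := h hP
    exact ⟨Ep, fun i => (hh i).2⟩

/-- Dictionary with v1: on a family where every spacing is read as ε = 1 (site-count units) the printed reading IS v1's
`MainThm`. [cite: Balaban1982Higgs2, Theorem (1.3) p.556] -/
theorem mainThmPrinted_iff_mainThm_of_eps_one (P : B2.Params) {I : Type} (eps : I → ℝ) (fam : I → PartitionData)
    (heps : ∀ i, eps i = 1) : MainThmPrinted P eps fam ↔ MainThm P fam := by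
  unfold MainThmPrinted MainThm
  simp only [heps, PartitionData.volEps_one]

/-- Dictionary with v1, upper bound. [cite: Balaban1982Higgs2, Theorem (1.3) p.556] -/
theorem upperBoundPrinted_iff_upperBound_of_eps_one (P : B2.Params) {I : Type} (eps : I → ℝ)
    (fam : I → PartitionData) (heps : ∀ i, eps i = 1) : UpperBoundPrinted P eps fam ↔ UpperBound P fam := by
  unfold UpperBoundPrinted UpperBound
  simp only [heps, PartitionData.volEps_one]

end Literature.MathematicalPhysics.QuantumFieldTheory.Balaban1983to89.B2Sect2Statements
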